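import Summits.BirchSwinnertonDyer.BirchSwinnertonDyer.Theorems.CountingDoorF2AtThreeDigitCertificateKernel

/-!
# Line `valuation-class-at-three` (**v3**) for crux I4loc `SchneiderOnDoorSubfamily` (route CountingDoorF2AtThree)

v3 (seat cd-valclass-digits, 2026-08-26) supersedes the registered v2 (4 stubs, load-bearing
`stub_heightCongruence` on the multiples `6•P₁, 6•P₂` — FALSE as typed: `ĥ₃(6P₁) ∈ 27ℤ₃` on the whole door
class, eng g5 13:38Z / eng-2 T12.md). Changes, all forced by evidence on stmt-BirchSwinnertonDyer-19682:

* STUB 1 is re-typed to the MINIMAL multiples `2•P₁, 3•P₂` (reduction orders `(2,3)` of `P̃₁ = (0,0)`,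
  `P̃₂ = (1,0)` on `y² + xy = x³ − x / 𝔽₃`) in the TWO-HEIGHT certificate shape consumed by the landed
  kernel `Theorems.schneiderConjecture_of_nonresidue_digits` (eng-2, p452361): first digits `d_A, d_B` of
  `ĥ₃(2P₁)/3`, `ĥ₃(3P₂)/3` with `d_A d_B ≡ 2 (mod 3)` and `ĥ₃(2P₁ + 3P₂) ∈ 3ℤ₃` — no third digit (eng-2
  T3b: the third digit is NOT class-constant); the digits are existential INSIDE the member quantifier.
  Certificate of record: class `c = (7,0,4,0) mod 9` of `(a₁,a₂,a₂',a₃)`, `(φ₂(P₁), φ₃(P₂)) ≡ (4, 7) mod 9`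
  ⇒ `(d_A, d_B) = (1, 2)` (kit j255085/j255100: 6 000/6 000; exact engine s4_residues.py; the seat's own
  check 2 000/2 000 arbitrary lifts). STUB 1 also exports the square-free sieve `ℓ² ∤ Δ(a)` at EVERY prime
  (type ∅: every rational point reduces non-singularly everywhere; the member's model is globally minimal).
* STUB 2 (`stub_regulator_ne_zero_of_near`) is DISCHARGED by the kernel p452361 and removed.
* STUB 3 (`stub_transport`) keeps its name and mathematical content; the skeleton-local `SchClause` is
  INLINED (a Theorems file cannot import `Summits.….Cruxes.…`, eng-2 14:59Z) and the square-free sieve is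
  added as a hypothesis (cd-transport 14:40Z RISK: the transport needs `u = ±1`, i.e. a minimal member).
* STUB 4 (`stub_hasDensityOn_one_of_forall`) LANDED (cd-density-one, p452042) and is used by name through
  `Theorems.schneiderOnDoorSubfamily_of_memberwise`.
No skeleton-local definitions remain: every registered signature is stated in tree vocabulary only.
-/

namespace Summit.BirchSwinnertonDyer.BirchSwinnertonDyer.Cruxes.SchneiderOnDoorSubfamily.ValuationClassAtThree

open scoped Classical
open WeierstrassCurve Literature.NumberTheory.EllipticCurves
open Literature.NumberTheory.EllipticCurves.BhargavaHo2022
open Summit.BirchSwinnertonDyer.BirchSwinnertonDyer.Theses.CountingDoorF2AtThree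

/-- **STUB 1 (v3) — first digits of the canonical `3`-adic heights of `2P₁`, `3P₂` on the valuation class
(load-bearing; memo S1+S2+S3+S4, size L).** An explicit large congruence subfamily
`Φ = F₂ ∩ {a ≡ (7,0,4,0) mod 9} ∩ {a ≡ (1,0,1,0) mod 25} ∩ {a ≡ (1,2,4,3) mod 49} ∩ {ℓ² ∤ Δ(a), ℓ ∉ {3,5,7}}`
with nonempty residue sets and a member (eng-2 T12.md §5: `a* = (−524, 450, −374, 3825)`), whose members satisfy
the local door conditions of `Theorems.leaf_of_local` and the square-free sieve at every prime, and such that for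
EVERY member and EVERY canonical `3`-adic height datum `Dh` on the member's model there are digits `d_A, d_B`
with `d_A d_B ≡ 2 (mod 3)`, `‖⟨2P₁,2P₁⟩/3 − d_A‖ < 1`, `‖⟨3P₂,3P₂⟩/3 − d_B‖ < 1` and `‖⟨2P₁+3P₂, 2P₁+3P₂⟩‖ ≤ 3⁻¹`
(first-order sigma–log evaluation `‖ĥ₃(nP) − log₃ φₙ(P)‖ ≤ ‖ψₙ(P)‖²` for a Mazur–Tate `σ₃`, exact denominator
`den x(nP) = ψₙ(P)²` on type ∅, `log₃ m ≡ (m² − 1)/2 (mod 9)`; the junk branch `σ = t` of `padicSigma` admits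
no canonical datum). -/
theorem stub_heightDigits :
    ∃ Φ : CongruenceFamily₂, Φ.IsLarge ∧ (∀ p : ℕ, p.Prime → (Φ.residues p).Nonempty) ∧
      (∃ a, Φ.Mem a) ∧
      (∀ a : Params, Φ.Mem a → a.curve.HasIrreducibleModPGaloisRep 3 ∧
        ∀ (C : VariableChange ℚ) (hC : (C • a.curve).IsGloballyMinimal),
          @IsOrdinaryAt (C • a.curve) hC 3 _ ∧ ∃ ℓ : ℕ, ∃ _ : Fact ℓ.Prime, ℓ ≠ 3 ∧
            (C • a.curve).HasMultiplicativeReductionAtPrime ℓ ∧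
            ¬ 3 ∣ padicValInt ℓ (@minimalDiscriminantInt (C • a.curve) hC)) ∧
      (∀ a : Params, Φ.Mem a → ∀ ℓ : ℕ, ℓ.Prime → ¬ ((ℓ : ℤ) ^ 2 ∣ a.curveInt.Δ)) ∧
      ∀ (a : Params) (h : Φ.Mem a) (Dh : PAdicHeightData a.curve 3), Dh.IsCanonical →
        ∃ dA dB : ℤ, dA * dB % 3 = 2 ∧
          ‖Dh.pairing (2 • a.markedPoint₁ h.1) (2 • a.markedPoint₁ h.1) / 3 - dA‖ < 1 ∧
          ‖Dh.pairing (3 • a.markedPoint₂ h.1) (3 • a.markedPoint₂ h.1) / 3 - dB‖ < 1 ∧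
          ‖Dh.pairing (2 • a.markedPoint₁ h.1 + 3 • a.markedPoint₂ h.1)
              (2 • a.markedPoint₁ h.1 + 3 • a.markedPoint₂ h.1)‖ ≤ (3 : ℝ)⁻¹ := by
  sorry

/-- **STUB 3 (v3) — transport (memo S6, size M).** For a member of `F₂` with square-free-sieved
discriminant (`ℓ² ∤ Δ(a)` at every prime, so `a.curve` is a globally minimal integral model and every
`C` to another globally minimal model has `u = ±1`, `r, s, t ∈ ℤ`), Schneider for every canonical datum on
`a.curve` (in rank 2) transfers to every globally minimal model `C • a.curve` (`PadicSigmaVariableChangeProofs`,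
`Rank2/CountingDoorTransport`; `mordellWeilRank` is model-invariant). v2's `SchClause` inlined. -/
theorem stub_transport (a : Params) (h : a.IsMember)
    (hΔ : ∀ ℓ : ℕ, ℓ.Prime → ¬ ((ℓ : ℤ) ^ 2 ∣ a.curveInt.Δ))
    (hS : ∀ Dh : PAdicHeightData a.curve 3, Dh.IsCanonical → a.curve.mordellWeilRank = 2 →
      SchneiderConjecture Dh) :
    ∀ (C : VariableChange ℚ) (hC : (C • a.curve).IsGloballyMinimal),
      @IsOrdinaryAt (C • a.curve) hC 3 _ → (C • a.curve).mordellWeilRank = 2 →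
        ∀ Dh : PAdicHeightData (C • a.curve) 3, Dh.IsCanonical → SchneiderConjecture Dh := by
  sorry

/-- **COMPOSITION (kernel-checked): the two stubs give the crux I4loc BY NAME**, through the landed
kernel `Theorems.schneiderConjecture_of_nonresidue_digits` (STUB 2 of v2) and
`Theorems.schneiderOnDoorSubfamily_of_memberwise` (STUB 4 of v2). -/
theorem SchneiderOnDoorSubfamily_of
    (h1 : ∃ Φ : CongruenceFamily₂, Φ.IsLarge ∧ (∀ p : ℕ, p.Prime → (Φ.residues p).Nonempty) ∧
      (∃ a, Φ.Mem a) ∧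
      (∀ a : Params, Φ.Mem a → a.curve.HasIrreducibleModPGaloisRep 3 ∧
        ∀ (C : VariableChange ℚ) (hC : (C • a.curve).IsGloballyMinimal),
          @IsOrdinaryAt (C • a.curve) hC 3 _ ∧ ∃ ℓ : ℕ, ∃ _ : Fact ℓ.Prime, ℓ ≠ 3 ∧
            (C • a.curve).HasMultiplicativeReductionAtPrime ℓ ∧
            ¬ 3 ∣ padicValInt ℓ (@minimalDiscriminantInt (C • a.curve) hC)) ∧
      (∀ a : Params, Φ.Mem a → ∀ ℓ : ℕ, ℓ.Prime → ¬ ((ℓ : ℤ) ^ 2 ∣ a.curveInt.Δ)) ∧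
      ∀ (a : Params) (h : Φ.Mem a) (Dh : PAdicHeightData a.curve 3), Dh.IsCanonical →
        ∃ dA dB : ℤ, dA * dB % 3 = 2 ∧
          ‖Dh.pairing (2 • a.markedPoint₁ h.1) (2 • a.markedPoint₁ h.1) / 3 - dA‖ < 1 ∧
          ‖Dh.pairing (3 • a.markedPoint₂ h.1) (3 • a.markedPoint₂ h.1) / 3 - dB‖ < 1 ∧
          ‖Dh.pairing (2 • a.markedPoint₁ h.1 + 3 • a.markedPoint₂ h.1)
              (2 • a.markedPoint₁ h.1 + 3 • a.markedPoint₂ h.1)‖ ≤ (3 : ℝ)⁻¹)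
    (h3 : ∀ (a : Params) (h : a.IsMember),
      (∀ ℓ : ℕ, ℓ.Prime → ¬ ((ℓ : ℤ) ^ 2 ∣ a.curveInt.Δ)) →
      (∀ Dh : PAdicHeightData a.curve 3, Dh.IsCanonical → a.curve.mordellWeilRank = 2 →
        SchneiderConjecture Dh) →
      ∀ (C : VariableChange ℚ) (hC : (C • a.curve).IsGloballyMinimal),
        @IsOrdinaryAt (C • a.curve) hC 3 _ → (C • a.curve).mordellWeilRank = 2 →
          ∀ Dh : PAdicHeightData (C • a.curve) 3, Dh.IsCanonical → SchneiderConjecture Dh) :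
    Summit.BirchSwinnertonDyer.BirchSwinnertonDyer.Theses.CountingDoorF2AtThree.SchneiderOnDoorSubfamily := by
  obtain ⟨Φ, hL, hne, hmem, hloc, hsq, hdig⟩ := h1
  refine Theorems.schneiderOnDoorSubfamily_of_memberwise Φ hL hne hloc hmem ?_
  intro a ha
  refine h3 a ha.1 (hsq a ha) ?_
  intro Dh hDh hrank
  haveI : a.curve.IsElliptic := Params.isElliptic_curve ha.1
  obtain ⟨dA, dB, h2, hA, hB, hC⟩ := hdig a ha Dh hDh
  exact Theorems.schneiderConjecture_of_nonresidue_digits Dh _ _ 2 3 hA hB hC h2 hrank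

/-- The line closes the crux from its stubs (sanity instance of the composition). -/
theorem SchneiderOnDoorSubfamily_of_stubs :
    Summit.BirchSwinnertonDyer.BirchSwinnertonDyer.Theses.CountingDoorF2AtThree.SchneiderOnDoorSubfamily :=
  SchneiderOnDoorSubfamily_of stub_heightDigits stub_transport

end Summit.BirchSwinnertonDyer.BirchSwinnertonDyer.Cruxes.SchneiderOnDoorSubfamily.ValuationClassAtThree
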